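import Mathlib
import Summits.Ventures.PercRepro2.Defs
import Summits.Ventures.PercRepro2.Harris
import Summits.Ventures.PercRepro2.CoinDefs
import Summits.Ventures.PercRepro2.CoinStarDefs
import Summits.Ventures.PercRepro2.CoinLsmCoreDefs
import Summits.Ventures.PercRepro2.CoinLsmCoreU
import Summits.Ventures.PercRepro2.CoinCoreGate
import Summits.Ventures.PercRepro2.CoinOrTailKDefs
import Summits.Ventures.PercRepro2.CoinOrTailKSums
import Summits.Ventures.PercRepro2.CoinOrTailLsmCore
import Summits.Ventures.PercRepro2.CoinTreeCore
import Summits.Ventures.PercRepro2.CoinKSureCore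
import Summits.Ventures.PercRepro2.CoinKSureTailSums
import Summits.Ventures.PercRepro2.CoinKSureGen
import Summits.Ventures.PercRepro2.CoinKSureCloseStar
import Summits.Ventures.PercRepro2.CoinKSureTwoLevel
import Summits.Ventures.PercRepro2.CoinKSureMarkerAB

/-!
# Row 2′DARC at an OR-tail with the two markers at TWO sure OR-vertices of the head
(blind cell PercRepro2, night-2 g16; proofs/NIGHT2-DARC.md §56.20, the entry `(b, b′)`)

Besides the OR-tail `a` (entries `ent ⊆ U`, sure) let `b` and `b′` be two further OR-vertices,
`b` entered only from `entb ⊆ U` (`OrTailK arcs s (insert a U) entb d b`) and `b′` only from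
`entb′ ⊆ U` (`OrTailK arcs s (insert b (insert a U)) entb′ d′ b′`), both by sure coins, arbitrary
out-arcs into the head.  A THIRD level reduction (`sum_gen` / `sum_gen_tail` for `b′` over the
core `U ∪ {a, b}`) turns the head into the OR-closure `closeB entb′ b′ A` and the marker
`1[b′ ∈ S⁺]` into `entInd entb′` (constant in `a` and `b`); the head commutes with the star
target (`closeB_star_comm`) and is replaced by the `b′`-erased closure on the levels; then §53's
two reductions and `orTailKSure_functional_nonneg_markers` with `x = entInd entb′`,
`y = entInd entb` close: `darc_of_orTailKSure_markerBB′ : DARC pr arcs s {t} b′ b a w`.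
-/

namespace Summit.Ventures.PercRepro2.Coin

open Classical

section MarkerBB2

variable {V : Type*} {E : Type*} [Fintype V] [DecidableEq V] [Fintype E] [DecidableEq E]
  {R : Type*} [Field R] [LinearOrder R] [IsStrictOrderedRing R]
  {arcs : E → Finset (V × V)} {s : V} {U : Finset V} {ent : Finset V} {c : V → E} {a w : V}
  {entb : Finset V} {d : V → E} {b : V} {entb' : Finset V} {d' : V → E} {b' : V}

omit [Fintype V] [Fintype E] [DecidableEq E] [Field R] [LinearOrder R] [IsStrictOrderedRing R] in
/-- The OR-closure commutes with the star target: for `b′ ≠ a`, `w ∉ entb′`. -/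
lemma closeB_star_comm (entb' : Finset V) {a b' w : V} (A : Finset V → R) (hba : b' ≠ a)
    (hwe : w ∉ entb') (W : Finset V) :
    closeB entb' b' (fun X => A (starTarget a w X)) W = closeB entb' b' A (starTarget a w W) := by
  unfold closeB
  have hent : (∃ r ∈ entb', r ∈ W) ↔ ∃ r ∈ entb', r ∈ starTarget a w W := by
    unfold starTarget
    split_ifs with haW
    · constructor
      · rintro ⟨r, hr, hrW⟩; exact ⟨r, hr, Finset.mem_insert_of_mem hrW⟩
      · rintro ⟨r, hr, hrW⟩
        rcases Finset.mem_insert.1 hrW with rfl | hrW'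
        · exact absurd hr hwe
        · exact ⟨r, hr, hrW'⟩
    · exact Iff.rfl
  have hst : starTarget a w (W ∪ {b'}) = starTarget a w W ∪ {b'} := by
    unfold starTarget
    have : a ∈ W ∪ {b'} ↔ a ∈ W := by
      rw [Finset.mem_union, Finset.mem_singleton]
      exact ⟨fun h => h.elim id (fun e => absurd e.symm hba), Or.inl⟩
    by_cases haW : a ∈ W
    · rw [if_pos (this.2 haW), if_pos haW]
      ext x; simp only [Finset.mem_insert, Finset.mem_union, Finset.mem_singleton]; tauto
    · rw [if_neg (fun h => haW (this.1 h)), if_neg haW]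
  by_cases h : ∃ r ∈ entb', r ∈ W
  · rw [if_pos h, if_pos (hent.1 h)]
    show A (starTarget a w (W ∪ {b'})) = A (starTarget a w W ∪ {b'})
    rw [hst]
  · rw [if_neg h, if_neg (fun h' => h (hent.2 h'))]

omit [Fintype V] [Fintype E] [DecidableEq E] [Field R] [LinearOrder R] [IsStrictOrderedRing R] in
/-- `closeBE` and `closeB` agree on sets not containing `b′`, in the `starTarget` form too. -/
lemma closeBE_star_of_notMem (entb' : Finset V) {a b' w : V} (A : Finset V → R)
    (hbw : b' ≠ w) {W : Finset V} (hW : b' ∉ W) :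
    closeB entb' b' A (starTarget a w W) = closeBE entb' b' A (starTarget a w W) := by
  rw [closeBE_of_notMem]
  unfold starTarget
  split_ifs
  · rw [Finset.mem_insert, not_or]; exact ⟨hbw, hW⟩
  · exact hW

/-- **THEOREM (row 2′DARC at an OR-tail, the markers at TWO sure OR-vertices of the head).**
`OrTailK arcs s U ent c a` (sure coins), `b` an OR-tail of `insert a U` (`entb`, sure, `a ∉ entb`),
`b′` an OR-tail of `insert b (insert a U)` (`entb′`, sure, `a ∉ entb′`, `b ∉ entb′`),
`SameEnds`, the cluster law of `U` log-supermodular, every head, every probability vector: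
`DARC pr arcs s {t} b′ b a w`. -/
theorem darc_of_orTailKSure_markerBB' (pr : E → R) (hp : IsProbVec pr) (hS : SameEnds arcs)
    (h : OrTailK arcs s U ent c a) (hb : OrTailK arcs s (insert a U) entb d b) (hae : a ∉ entb)
    (hb' : OrTailK arcs s (insert b (insert a U)) entb' d' b') (hae' : a ∉ entb') (hbe' : b ∉ entb')
    (hsure : ∀ r ∈ ent, pr (c r) = 1) (hsureb : ∀ r ∈ entb, pr (d r) = 1)
    (hsureb' : ∀ r ∈ entb', pr (d' r) = 1)
    (hν : ∀ W W', W ⊆ U → W' ⊆ U →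
      prob pr (coreLevel arcs s U W) * prob pr (coreLevel arcs s U W') ≤
        prob pr (coreLevel arcs s U (W ∩ W')) * prob pr (coreLevel arcs s U (W ∪ W')))
    {t : V} (htC : t ∉ insert b' (insert b (insert a U))) (hts : t ≠ s) (hws : w ≠ s)
    (hwC : w ∉ insert b' (insert b (insert a U))) :
    DARC pr arcs s {t} b' b a w := by
  have hC := hb'.closedInCoreU
  have hba : b ≠ a := fun e => hb.a_notin (e ▸ Finset.mem_insert_self a U)
  have hbU : b ∉ U := fun hbU => hb.a_notin (Finset.mem_insert_of_mem hbU)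
  have hb'a : b' ≠ a := by
    intro e
    apply hb'.a_notin
    rw [e]
    exact Finset.mem_insert_of_mem (Finset.mem_insert_self a U)
  have hb'b : b' ≠ b := by
    intro e
    apply hb'.a_notin
    rw [e]
    exact Finset.mem_insert_self b _
  have hb'U : b' ∉ U := fun hU => hb'.a_notin (Finset.mem_insert_of_mem (Finset.mem_insert_of_mem hU))
  have hbC : b ∈ insert b' (insert b (insert a U)) :=
    Finset.mem_insert_of_mem (Finset.mem_insert_self _ _)
  have hb'C : b' ∈ insert b' (insert b (insert a U)) := Finset.mem_insert_self _ _
  have haC : a ∈ insert b' (insert b (insert a U)) :=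
    Finset.mem_insert_of_mem (Finset.mem_insert_of_mem (Finset.mem_insert_self _ _))
  have hwe : w ∉ entb := fun hw =>
    hwC (Finset.mem_insert_of_mem (Finset.mem_insert_of_mem (hb.ent_sub hw)))
  have hwe' : w ∉ entb' := fun hw => hwC (Finset.mem_insert_of_mem (hb'.ent_sub hw))
  have hbw : b ≠ w := fun e => hwC (e ▸ hbC)
  have hb'w : b' ≠ w := fun e => hwC (e ▸ hb'C)
  unfold DARC
  rw [hC.phiC_gate_eq pr hS htC hts hb'C hbC haC hws hwC]
  set A : Finset V → R :=
    fun X => prob pr (coreAvoidEvent arcs s t (insert b' (insert b (insert a U))) X) with hAdef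
  -- the outermost level reduction (the OR-tail `b′` over `U ∪ {a, b}`)
  set A₁ : Finset V → R := closeBE entb' b' A with hA₁def
  have hm1b' : ∀ W : Finset V, (fun _ : Finset V => (1 : R)) (insert b' W) = (fun _ => (1 : R)) W :=
    fun _ => rfl
  have hmbb' : ∀ W : Finset V, (fun W : Finset V => if b ∈ W then (1 : R) else 0) (insert b' W) =
      (fun W : Finset V => if b ∈ W then (1 : R) else 0) W := by
    intro W; simp only [Finset.mem_insert, hb'b.symm, false_or]
  have hg0 : ∀ W : Finset V, b' ∉ W → (fun W : Finset V => if b' ∈ W then (1 : R) else 0) W = 0 := by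
    intro W hW; simp only [hW, if_false]
  have hg1 : ∀ W : Finset V, b' ∉ W →
      (fun W : Finset V => if b' ∈ W then (1 : R) else 0) (insert b' W) = (fun _ => (1 : R)) W := by
    intro W _; simp only [Finset.mem_insert_self, if_true]
  have hq0 : ∀ W : Finset V, b' ∉ W →
      (fun W : Finset V => (if b' ∈ W then (1 : R) else 0) * (if b ∈ W then (1 : R) else 0)) W = 0 := by
    intro W hW; simp only [hW, if_false, zero_mul]
  have hq1 : ∀ W : Finset V, b' ∉ W →
      (fun W : Finset V => (if b' ∈ W then (1 : R) else 0) * (if b ∈ W then (1 : R) else 0))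
          (insert b' W) = (fun W : Finset V => if b ∈ W then (1 : R) else 0) W := by
    intro W _
    simp only [Finset.mem_insert_self, if_true, one_mul, Finset.mem_insert, hb'b.symm, false_or]
  -- after the `b′`-reduction every level `W ⊆ U ∪ {a, b}` misses `b′`
  have hWb' : ∀ W ∈ (insert b (insert a U)).powerset, b' ∉ W := by
    intro W hW hb'W
    have := Finset.mem_powerset.1 hW hb'W
    rw [Finset.mem_insert, Finset.mem_insert] at this
    rcases this with e | e | e
    · exact hb'b e
    · exact hb'a e
    · exact hb'U e
  -- R-side reductions: `F = A`; gate side: `F = A ∘ starTarget a w`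
  have redR : ∀ m : Finset V → R, (∀ W, m (insert b' W) = m W) →
      ∑ W ∈ (insert b' (insert b (insert a U))).powerset,
          prob pr (coreLevel arcs s (insert b' (insert b (insert a U))) W) * A W * m W =
        ∑ W ∈ (insert b (insert a U)).powerset,
          prob pr (coreLevel arcs s (insert b (insert a U)) W) * A₁ W * m W := by
    intro m hm
    rw [hb'.sum_gen pr A m hm]
    refine Finset.sum_congr rfl fun W hW => ?_
    rw [closeB_of_sure pr d' b' A hsureb' W, hA₁def, closeBE_of_notMem entb' b' A (hWb' W hW)]
  have redRtail : ∀ g m : Finset V → R, (∀ W, b' ∉ W → g W = 0) →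
      (∀ W, b' ∉ W → g (insert b' W) = m W) →
      ∑ W ∈ (insert b' (insert b (insert a U))).powerset,
          prob pr (coreLevel arcs s (insert b' (insert b (insert a U))) W) * A W * g W =
        ∑ W ∈ (insert b (insert a U)).powerset,
          prob pr (coreLevel arcs s (insert b (insert a U)) W) * A₁ W * (entInd entb' W * m W) := by
    intro g m hg0 hg1
    rw [hb'.sum_gen_tail pr A g m hg0 hg1]
    refine Finset.sum_congr rfl fun W hW => ?_
    rw [closeB_of_sure_tail pr d' b' A hsureb' W, hA₁def, closeBE_of_notMem entb' b' A (hWb' W hW)]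
    unfold entInd; ring
  have redG : ∀ m : Finset V → R, (∀ W, m (insert b' W) = m W) →
      ∑ W ∈ (insert b' (insert b (insert a U))).powerset,
          prob pr (coreLevel arcs s (insert b' (insert b (insert a U))) W) *
            A (starTarget a w W) * m W =
        ∑ W ∈ (insert b (insert a U)).powerset,
          prob pr (coreLevel arcs s (insert b (insert a U)) W) * A₁ (starTarget a w W) * m W := by
    intro m hm
    rw [hb'.sum_gen pr (fun X => A (starTarget a w X)) m hm]
    refine Finset.sum_congr rfl fun W hW => ?_
    have e1 := closeB_of_sure pr d' b' (fun X => A (starTarget a w X)) hsureb' W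
    beta_reduce at e1
    rw [e1, closeB_star_comm entb' A hb'a hwe' W, hA₁def,
      closeBE_star_of_notMem entb' A hb'w (hWb' W hW)]
  have redGtail : ∀ g m : Finset V → R, (∀ W, b' ∉ W → g W = 0) →
      (∀ W, b' ∉ W → g (insert b' W) = m W) →
      ∑ W ∈ (insert b' (insert b (insert a U))).powerset,
          prob pr (coreLevel arcs s (insert b' (insert b (insert a U))) W) *
            A (starTarget a w W) * g W =
        ∑ W ∈ (insert b (insert a U)).powerset,
          prob pr (coreLevel arcs s (insert b (insert a U)) W) * A₁ (starTarget a w W) *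
            (entInd entb' W * m W) := by
    intro g m hg0 hg1
    rw [hb'.sum_gen_tail pr (fun X => A (starTarget a w X)) g m hg0 hg1]
    refine Finset.sum_congr rfl fun W hW => ?_
    have e1 := closeB_of_sure_tail pr d' b' (fun X => A (starTarget a w X)) hsureb' W
    beta_reduce at e1
    rw [e1, closeB_star_comm entb' A hb'a hwe' W, hA₁def,
      closeBE_star_of_notMem entb' A hb'w (hWb' W hW)]
    unfold entInd; ring
  have r1 := redR (fun _ => (1 : R)) hm1b'
  have r2 := redR (fun W => if b ∈ W then (1 : R) else 0) hmbb'
  have r3 := redRtail (fun W => if b' ∈ W then (1 : R) else 0) (fun _ => (1 : R)) hg0 hg1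
  have r4 := redG (fun _ => (1 : R)) hm1b'
  have r5 := redG (fun W => if b ∈ W then (1 : R) else 0) hmbb'
  have r6 := redGtail (fun W => if b' ∈ W then (1 : R) else 0) (fun _ => (1 : R)) hg0 hg1
  have r7 := redGtail (fun W => (if b' ∈ W then (1 : R) else 0) * (if b ∈ W then (1 : R) else 0))
      (fun W => if b ∈ W then (1 : R) else 0) hq0 hq1
  simp only [mul_one] at r1 r3 r4 r6
  rw [r1, r2, r3, r4, r5, r6, r7]
  -- now the §53 two level reductions with the head `A₁` and the marker `entInd entb′`
  have hm1b : ∀ W : Finset V, (fun _ : Finset V => (1 : R)) (insert b W) = (fun _ => (1 : R)) W :=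
    fun _ => rfl
  have hm1a : ∀ W : Finset V, (fun _ : Finset V => (1 : R)) (insert a W) = (fun _ => (1 : R)) W :=
    fun _ => rfl
  have hxb : ∀ W : Finset V, (fun W : Finset V => entInd entb' W * (1 : R)) (insert b W) =
      (fun W : Finset V => entInd entb' W * (1 : R)) W := by
    intro W; simp only [mul_one]; exact entInd_insert_of_notMem entb' hbe' W
  have hxa : ∀ W : Finset V, (fun W : Finset V => entInd entb' W * (1 : R)) (insert a W) =
      (fun W : Finset V => entInd entb' W * (1 : R)) W := by
    intro W; simp only [mul_one]; exact entInd_insert_of_notMem entb' hae' W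
  have hgb0 : ∀ W : Finset V, b ∉ W → (fun W : Finset V => if b ∈ W then (1 : R) else 0) W = 0 := by
    intro W hbW; simp only [hbW, if_false]
  have hgb1 : ∀ W : Finset V, b ∉ W →
      (fun W : Finset V => if b ∈ W then (1 : R) else 0) (insert b W) = (fun _ => (1 : R)) W := by
    intro W _; simp only [Finset.mem_insert_self, if_true]
  have hgq0 : ∀ W : Finset V, b ∉ W →
      (fun W : Finset V => entInd entb' W * (if b ∈ W then (1 : R) else 0)) W = 0 := by
    intro W hbW; simp only [hbW, if_false, mul_zero]
  have hgq1 : ∀ W : Finset V, b ∉ W →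
      (fun W : Finset V => entInd entb' W * (if b ∈ W then (1 : R) else 0)) (insert b W) =
        (fun W : Finset V => entInd entb' W * (1 : R)) W := by
    intro W _
    simp only [Finset.mem_insert_self, if_true, entInd_insert_of_notMem entb' hbe' W]
  have eΛ := two_level_R h hb pr hsureb A₁ (fun _ => (1 : R)) hm1b hm1a
  have eΛx := two_level_R h hb pr hsureb A₁ (fun W => entInd entb' W * (1 : R)) hxb hxa
  have eΛb := two_level_R_tail h hb hae pr hsureb A₁ (fun W => if b ∈ W then (1 : R) else 0)
    (fun _ => (1 : R)) hgb0 hgb1 hm1a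
  have eM := two_level_G h hb hae hwe hba pr hsureb A₁ (fun _ => (1 : R)) hm1b hm1a
  have eMx := two_level_G h hb hae hwe hba pr hsureb A₁ (fun W => entInd entb' W * (1 : R)) hxb hxa
  have eMb := two_level_G_tail h hb hae hwe hba pr hsureb A₁
    (fun W => if b ∈ W then (1 : R) else 0) (fun _ => (1 : R)) hgb0 hgb1 hm1a
  have eMxb := two_level_G_tail h hb hae hwe hba pr hsureb A₁
    (fun W => entInd entb' W * (if b ∈ W then (1 : R) else 0))
    (fun W => entInd entb' W * (1 : R)) hgq0 hgq1 hxa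
  simp only [mul_one] at eΛ eΛx eΛb eM eMx eMb eMxb
  rw [eΛ, eΛx, eΛb, eM, eMx, eMb, eMxb]
  -- the `b`-erased head
  have hbW : ∀ W ∈ U.powerset, b ∉ W := fun W hW hbW => hbU (Finset.mem_powerset.1 hW hbW)
  have c1 : ∑ x ∈ U.powerset, prob pr (coreLevel arcs s U x) * rValK (closeB entb b A₁) pr ent c a x =
      ∑ x ∈ U.powerset, prob pr (coreLevel arcs s U x) * rValK (closeBE entb b A₁) pr ent c a x :=
    Finset.sum_congr rfl fun W hW => by rw [rValK_closeBE A₁ pr (hbW W hW) hba]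
  have c2 : ∑ x ∈ U.powerset, prob pr (coreLevel arcs s U x) * rValK (closeB entb b A₁) pr ent c a x *
      entInd entb' x =
      ∑ x ∈ U.powerset, prob pr (coreLevel arcs s U x) * rValK (closeBE entb b A₁) pr ent c a x *
        entInd entb' x :=
    Finset.sum_congr rfl fun W hW => by rw [rValK_closeBE A₁ pr (hbW W hW) hba]
  have c3 : ∑ x ∈ U.powerset, prob pr (coreLevel arcs s U x) * rValK (closeB entb b A₁) pr ent c a x *
      entInd entb x =
      ∑ x ∈ U.powerset, prob pr (coreLevel arcs s U x) * rValK (closeBE entb b A₁) pr ent c a x *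
        entInd entb x :=
    Finset.sum_congr rfl fun W hW => by rw [rValK_closeBE A₁ pr (hbW W hW) hba]
  have c4 : ∑ x ∈ U.powerset, prob pr (coreLevel arcs s U x) * gValK (closeB entb b A₁) pr ent c a w x =
      ∑ x ∈ U.powerset, prob pr (coreLevel arcs s U x) * gValK (closeBE entb b A₁) pr ent c a w x :=
    Finset.sum_congr rfl fun W hW => by rw [gValK_closeBE A₁ pr (hbW W hW) hba hbw]
  have c5 : ∑ x ∈ U.powerset, prob pr (coreLevel arcs s U x) * gValK (closeB entb b A₁) pr ent c a w x *
      entInd entb' x =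
      ∑ x ∈ U.powerset, prob pr (coreLevel arcs s U x) * gValK (closeBE entb b A₁) pr ent c a w x *
        entInd entb' x :=
    Finset.sum_congr rfl fun W hW => by rw [gValK_closeBE A₁ pr (hbW W hW) hba hbw]
  have c6 : ∑ x ∈ U.powerset, prob pr (coreLevel arcs s U x) * gValK (closeB entb b A₁) pr ent c a w x *
      entInd entb x =
      ∑ x ∈ U.powerset, prob pr (coreLevel arcs s U x) * gValK (closeBE entb b A₁) pr ent c a w x *
        entInd entb x :=
    Finset.sum_congr rfl fun W hW => by rw [gValK_closeBE A₁ pr (hbW W hW) hba hbw]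
  have c7 : ∑ x ∈ U.powerset, prob pr (coreLevel arcs s U x) * gValK (closeB entb b A₁) pr ent c a w x *
      (entInd entb x * entInd entb' x) =
      ∑ x ∈ U.powerset, prob pr (coreLevel arcs s U x) * gValK (closeBE entb b A₁) pr ent c a w x *
        (entInd entb' x * entInd entb x) :=
    Finset.sum_congr rfl fun W hW => by rw [gValK_closeBE A₁ pr (hbW W hW) hba hbw]; ring
  rw [c1, c2, c3, c4, c5, c6, c7]
  obtain ⟨hA0, hAmono, hAlsm⟩ :=
    OrTailU.head_props (U := insert b (insert a U)) (a := b') pr hp hS t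
  have hA₁0 := closeBE_nonneg entb' b' A hA0
  have hA₁mono := closeBE_mono entb' b' A hAmono
  have hA₁lsm := closeBE_lsm entb' b' A hA0 hAlsm hAmono
  exact orTailKSure_functional_nonneg_markers U (fun W => prob pr (coreLevel arcs s U W))
    (closeBE entb b A₁) pr ent c a w (fun W => entInd entb' W) (fun W => entInd entb W)
    hp.nonneg hp.le_one hsure (fun W => prob_nonneg hp _)
    (fun s' hs' t' ht' => hν s' t' hs' ht') (closeBE_nonneg entb b A₁ hA₁0)
    (closeBE_lsm entb b A₁ hA₁0 hA₁lsm hA₁mono) (closeBE_mono entb b A₁ hA₁mono)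
    (fun W => entInd_nonneg entb' W) (fun W => entInd_nonneg entb W)
    (fun s t => entInd_mono entb' s t) (fun s t => entInd_mono entb s t)

end MarkerBB2

end Summit.Ventures.PercRepro2.Coin
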